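import Mathlib.Analysis.SpecialFunctions.Pow.Deriv
import Mathlib.Analysis.Calculus.MeanValue
import Mathlib.Analysis.SumIntegralComparisons
import Mathlib.Analysis.SpecialFunctions.ImproperIntegrals
import Literature.NumberTheory.LFunctions.RealCharacterPartialSums
import HarnessLib

/-!
# Dirichlet `L`-functions in `Re s > 0` by iterated Abel summation

Topic `Literature/NumberTheory/LFunctions` (namespace `Literature.NumberTheory.LFunctions`,
grouping sub-namespace `IteratedAbel`). Everything in this file is PROVED. For a NON-PRINCIPAL
Dirichlet character `χ` mod `q` the partial sums `S(n) = Σ_{m ≤ n} χ(m)` are `q`-periodic and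
bounded by `q` (Montgomery–Vaughan (4.23)); one summation by parts (MV Thm. 1.3; the tree's
`DirichletAbel.LFunction_sub_sum_eq`) gives `L(s, χ) = Σ_{n ≤ N} χ(n) n^{−s} + O(q |s| N^{−σ}/σ)`
on `σ > 0`. For the mean-square theory in `1/2 < σ < 1` (approximation of `L(σ+it, χ)`,
`|t| ≤ T`, by a Dirichlet polynomial of length `N ≈ T^{1+δ}` with error `O(N^{−σ})`, as the
Euler–Maclaurin formula of high order does for `ζ` in the tree's
`ZetaEulerProductMeanSquare.lean`) the factor `|s|` is fatal, and we iterate: each further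
summation by parts trades one finite difference on `n^{−s}`
(`‖Δ^j(n^{−s})‖ ≤ (‖s‖+j)^j n^{−σ−j}`, `norm_fdPow_le`) for the mean-free antiderivative of a
periodic bounded sequence (again periodic and bounded, `anti_periodic`, `norm_anti_le`), the
means producing explicit boundary terms of size `N^{−σ}`:

* `IteratedAbel.norm_LFunction_sub_sum_le_iterated` — for `χ ≠ χ₀` mod `q`, `k ≥ 1`,
  `σ = Re s > 0` and `‖s‖ + k ≤ N`:
  `‖L(s, χ) − Σ_{n=1}^{N} χ(n) n^{−s}‖ ≤ 2q (6q)^k (N^{−σ} + (‖s‖+k)^k N^{1−σ−k}/(σ+k−1))`.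

Intermediate results (all proved): the differences `fdPow j s x = Δ^j(x^{−s})` of a real
variable, their derivative `−s Δ^j(x^{−s−1})` and size; Abel summation of absolutely convergent
series (`tsum_abel`) and telescoping (`hasSum_fdiff`); the periodic mean-free antiderivative
(`mean`, `anti`); the tail series `tailSum s N j u = Σ_{n>N} u(n) Δ^j(n^{−s})`, one Abel step on
it (`tailSum_eq`) and the iterated bound (`norm_tailSum_le_of_add_eq`, induction on the number of
steps), with the integral test for `Σ_{n>N} n^{−σ−j}` (Mathlib's
`AntitoneOn.tsum_comp_add_le_integral`). This is the classical treatment of Dirichlet series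
with periodic coefficients by repeated partial summation; we cite Montgomery–Vaughan for the
summation by parts and the bound on the partial sums of `χ`.

## References

* [MontgomeryVaughan2007] H. L. Montgomery, R. C. Vaughan, *Multiplicative Number Theory I*,
  CUP 2007, §1.3 Thm. 1.3 (summation by parts), §4.3 (4.20)–(4.23) and Thm. 4.8 (partial sums
  of a non-principal character, `L(s, χ)` on `σ > 0`).
-/

noncomputable section

open Complex Filter Topology Set Finset

namespace Literature.NumberTheory.LFunctions

namespace IteratedAbel

/-! ### Finite differences of `x ↦ x^{-s}` -/

/-- The `j`-th forward difference (step `1`) of `x ↦ x^{-s}` as a function of the real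
variable `x`: `Δ⁰ = x^{-s}`, `Δ^{j+1} f(x) = Δ^j f(x+1) − Δ^j f(x)`. [folklore] -/
def fdPow : ℕ → ℂ → ℝ → ℂ
  | 0, s, x => (x : ℂ) ^ (-s)
  | j + 1, s, x => fdPow j s (x + 1) - fdPow j s x

/-- [folklore] -/
theorem fdPow_zero (s : ℂ) (x : ℝ) : fdPow 0 s x = (x : ℂ) ^ (-s) := rfl

/-- [folklore] -/
theorem fdPow_succ (j : ℕ) (s : ℂ) (x : ℝ) :
    fdPow (j + 1) s x = fdPow j s (x + 1) - fdPow j s x := rfl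

/-- `d/dx Δ^j(x^{-s}) = −s Δ^j(x^{-s-1})` for `x > 0` (differences commute with derivatives).
[folklore] -/
theorem hasDerivAt_fdPow (j : ℕ) (s : ℂ) {x : ℝ} (hx : 0 < x) :
    HasDerivAt (fdPow j s) (-s * fdPow j (s + 1) x) x := by
  induction j generalizing x with
  | zero =>
    have h1 : HasDerivAt (fun y : ℂ ↦ y ^ (-s)) (-s * (x : ℂ) ^ (-s - 1)) (x : ℂ) :=
      (Complex.hasStrictDerivAt_cpow_const (Or.inl (by simpa using hx))).hasDerivAt
    have h2 := h1.comp_ofReal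
    have e : (fdPow 0 s) = fun y : ℝ ↦ (y : ℂ) ^ (-s) := by funext y; rfl
    rw [e]
    refine h2.congr_deriv ?_
    rw [fdPow_zero, neg_add']
  | succ j ih =>
    have e : fdPow (j + 1) s = fun y : ℝ ↦ fdPow j s (y + 1) - fdPow j s y := by
      funext y; rfl
    rw [e]
    have h1 : HasDerivAt (fun y : ℝ ↦ fdPow j s (y + 1)) (-s * fdPow j (s + 1) (x + 1)) x :=
      (ih (by linarith)).comp_add_const x 1
    have h2 := ih hx
    refine (h1.sub h2).congr_deriv ?_
    rw [fdPow_succ]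
    ring

/-- **Size of the differences**: for `Re s ≥ 0`, `x ≥ 1`,
`‖Δ^j(x^{-s})‖ ≤ (‖s‖ + j)^j x^{−Re s − j}` (mean value inequality, `j` times). [folklore] -/
theorem norm_fdPow_le (j : ℕ) :
    ∀ (s : ℂ), 0 ≤ s.re → ∀ {x : ℝ}, 1 ≤ x →
      ‖fdPow j s x‖ ≤ (‖s‖ + j) ^ j * x ^ (-s.re - j) := by
  induction j with
  | zero =>
    intro s _ x hx
    rw [fdPow_zero, Complex.norm_cpow_eq_rpow_re_of_pos (by linarith), neg_re]
    simp
  | succ j ih =>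
    intro s hs x hx
    rw [fdPow_succ]
    have hs1 : 0 ≤ (s + 1).re := by simp; linarith
    -- mean value inequality on `[x, x+1]`
    have hderiv : ∀ y ∈ Icc x (x + 1),
        HasDerivWithinAt (fdPow j s) (-s * fdPow j (s + 1) y) (Icc x (x + 1)) y :=
      fun y hy ↦ (hasDerivAt_fdPow j s (by linarith [hy.1])).hasDerivWithinAt
    have hbound : ∀ y ∈ Icc x (x + 1),
        ‖-s * fdPow j (s + 1) y‖ ≤ ‖s‖ * ((‖s + 1‖ + j) ^ j * x ^ (-(s + 1).re - j)) := by
      intro y hy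
      rw [norm_mul, norm_neg]
      refine mul_le_mul_of_nonneg_left ((ih (s + 1) hs1 (hx.trans hy.1)).trans ?_) (norm_nonneg _)
      refine mul_le_mul_of_nonneg_left ?_ (by positivity)
      exact Real.rpow_le_rpow_of_nonpos (by linarith) hy.1 (by simp; linarith)
    have hmv := Convex.norm_image_sub_le_of_norm_hasDerivWithin_le hderiv hbound (convex_Icc x (x + 1))
      (left_mem_Icc.2 (by linarith)) (right_mem_Icc.2 (by linarith))
    rw [show x + 1 - x = 1 by ring, norm_one, mul_one] at hmv
    refine hmv.trans ?_
    -- `‖s‖ (‖s+1‖ + j)^j x^{-σ-1-j} ≤ (‖s‖ + j + 1)^{j+1} x^{-σ-(j+1)}`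
    have hx0 : 0 < x := by linarith
    have e1 : x ^ (-(s + 1).re - j) = x ^ (-s.re - ((j + 1 : ℕ) : ℝ)) := by
      congr 1; push_cast; simp; ring
    rw [e1, ← mul_assoc]
    refine mul_le_mul_of_nonneg_right ?_ (Real.rpow_nonneg hx0.le _)
    have h1 : ‖s + 1‖ + j ≤ ‖s‖ + ((j + 1 : ℕ) : ℝ) := by
      push_cast
      linarith [norm_add_le s 1, norm_one (α := ℂ)]
    have h2 : ‖s‖ ≤ ‖s‖ + ((j + 1 : ℕ) : ℝ) := by push_cast; linarith
    calc ‖s‖ * (‖s + 1‖ + j) ^ j ≤ (‖s‖ + ((j + 1 : ℕ) : ℝ)) * (‖s‖ + ((j + 1 : ℕ) : ℝ)) ^ j := by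
          gcongr
      _ = (‖s‖ + ((j + 1 : ℕ) : ℝ)) ^ (j + 1) := by ring

/-! ### Differences of sequences; Abel summation of absolutely convergent series -/

/-- The forward difference of a sequence. [folklore] -/
def fdiff (F : ℕ → ℂ) (n : ℕ) : ℂ := F (n + 1) - F n

/-- The differences of `n ↦ Δ^j(n^{-s})` are `Δ^{j+1}(n^{-s})`. [folklore] -/
theorem fdiff_fdPow (j : ℕ) (s : ℂ) (n : ℕ) :
    fdiff (fun m : ℕ ↦ fdPow j s m) n = fdPow (j + 1) s n := by
  rw [fdiff, fdPow_succ]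
  push_cast
  ring_nf

/-- **Telescoping**: if `F → 0` and the differences are summable beyond `K`, then
`Σ_{n ≥ 0} (F(n+K+1) − F(n+K)) = −F(K)`. [folklore] -/
theorem hasSum_fdiff {F : ℕ → ℂ} (K : ℕ) (hF : Tendsto F atTop (𝓝 0))
    (hs : Summable fun n ↦ fdiff F (n + K)) : HasSum (fun n ↦ fdiff F (n + K)) (-F K) := by
  rw [hs.hasSum_iff_tendsto_nat]
  have htel : ∀ M : ℕ, ∑ n ∈ Finset.range M, fdiff F (n + K) = F (M + K) - F K := by
    intro M
    induction M with
    | zero => simp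
    | succ M ih =>
      rw [Finset.sum_range_succ, ih, fdiff, show M + K + 1 = M + 1 + K by ring]
      ring
  simp_rw [htel]
  have h := (hF.comp (tendsto_add_atTop_nat K)).sub_const (F K)
  rw [zero_sub] at h
  exact h

/-- **Abel summation, absolutely convergent form.** If `U` is bounded, `G → 0`, and the two
series below converge, then
`Σ_{n≥0} (U(n+K+1) − U(n+K)) G(n+K+1) = −U(K) G(K+1) − Σ_{n≥0} U(n+K+1) (G(n+K+2) − G(n+K+1))`.
[cite: MontgomeryVaughan2007, §1.3 Thm. 1.3] -/
theorem tsum_abel {U G : ℕ → ℂ} {B : ℝ} (hU : ∀ n, ‖U n‖ ≤ B) (hG : Tendsto G atTop (𝓝 0))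
    (K : ℕ) (h1 : Summable fun n ↦ (U (n + K + 1) - U (n + K)) * G (n + K + 1))
    (h2 : Summable fun n ↦ U (n + K + 1) * fdiff G (n + K + 1)) :
    ∑' n, (U (n + K + 1) - U (n + K)) * G (n + K + 1) =
      -(U K * G (K + 1)) - ∑' n, U (n + K + 1) * fdiff G (n + K + 1) := by
  -- the finite identity
  have hfin : ∀ M : ℕ, ∑ n ∈ Finset.range M, (U (n + K + 1) - U (n + K)) * G (n + K + 1) +
      ∑ n ∈ Finset.range M, U (n + K + 1) * fdiff G (n + K + 1) =
      U (M + K) * G (M + K + 1) - U K * G (K + 1) := by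
    intro M
    induction M with
    | zero => simp
    | succ M ih =>
      rw [Finset.sum_range_succ, Finset.sum_range_succ, add_add_add_comm, ih, fdiff,
        show M + 1 + K = M + K + 1 by ring, show M + K + 1 + 1 = M + K + 2 by ring]
      ring
  -- limits
  have hl1 := h1.hasSum.tendsto_sum_nat
  have hl2 := h2.hasSum.tendsto_sum_nat
  have hl3 : Tendsto (fun M : ℕ ↦ U (M + K) * G (M + K + 1) - U K * G (K + 1)) atTop
      (𝓝 (0 - U K * G (K + 1))) := by
    refine Tendsto.sub_const ?_ _
    have hbd : ∀ M, ‖U (M + K) * G (M + K + 1)‖ ≤ B * ‖G (M + K + 1)‖ := fun M ↦ by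
      rw [norm_mul]; exact mul_le_mul_of_nonneg_right (hU _) (norm_nonneg _)
    have hlim : Tendsto (fun M : ℕ ↦ B * ‖G (M + K + 1)‖) atTop (𝓝 0) := by
      have h := ((hG.comp (tendsto_add_atTop_nat (K + 1))).norm).const_mul B
      rw [norm_zero, mul_zero] at h
      have e : (fun M : ℕ ↦ B * ‖G (M + K + 1)‖) =
          fun M ↦ B * ‖(G ∘ fun n ↦ n + (K + 1)) M‖ := by
        funext M; simp only [Function.comp_apply, add_assoc]
      rw [e]; exact h
    exact squeeze_zero_norm hbd hlim
  have hsum := hl1.add hl2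
  simp_rw [hfin] at hsum
  have heq := tendsto_nhds_unique hsum hl3
  rw [zero_sub] at heq
  exact eq_sub_of_add_eq heq

/-! ### Periodic bounded sequences and their mean-free antiderivatives -/

/-- The mean of `u(1), …, u(q)`. [folklore] -/
def mean (q : ℕ) (u : ℕ → ℂ) : ℂ := (∑ i ∈ Finset.range q, u (i + 1)) / q

/-- The mean-free antiderivative `U(n) = Σ_{m=1}^{n} (u(m) − mean)`, `U(0) = 0`. [folklore] -/
def anti (q : ℕ) (u : ℕ → ℂ) (n : ℕ) : ℂ := ∑ i ∈ Finset.range n, (u (i + 1) - mean q u)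

/-- [folklore] -/
theorem anti_succ_sub (q : ℕ) (u : ℕ → ℂ) (n : ℕ) :
    anti q u (n + 1) - anti q u n = u (n + 1) - mean q u := by
  rw [anti, anti, Finset.sum_range_succ]; ring

/-- A sum over a full period is invariant under shifts. [folklore] -/
theorem sum_range_shift_of_periodic {q : ℕ} {u : ℕ → ℂ} (hu : ∀ n, u (n + q) = u n) (n : ℕ) :
    ∑ i ∈ Finset.range q, u (n + i + 1) = ∑ i ∈ Finset.range q, u (i + 1) := by
  induction n with
  | zero => simp
  | succ n ih =>
    have h1 := Finset.sum_range_succ' (fun i ↦ u (n + i + 1)) q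
    have h2 := Finset.sum_range_succ (fun i ↦ u (n + i + 1)) q
    have h3 : u (n + q + 1) = u (n + 0 + 1) := by
      rw [show n + q + 1 = (n + 1) + q by ring, hu]
    have key : ∑ i ∈ Finset.range q, u (n + (i + 1) + 1) = ∑ i ∈ Finset.range q, u (n + i + 1) := by
      linear_combination h2 - h1 + h3
    calc ∑ i ∈ Finset.range q, u (n + 1 + i + 1)
        = ∑ i ∈ Finset.range q, u (n + (i + 1) + 1) :=
          Finset.sum_congr rfl fun i _ ↦ by ring_nf
      _ = ∑ i ∈ Finset.range q, u (n + i + 1) := key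
      _ = ∑ i ∈ Finset.range q, u (i + 1) := ih

/-- The antiderivative of a `q`-periodic sequence is `q`-periodic (`q ≥ 1`). [folklore] -/
theorem anti_periodic {q : ℕ} (hq : 0 < q) {u : ℕ → ℂ} (hu : ∀ n, u (n + q) = u n) (n : ℕ) :
    anti q u (n + q) = anti q u n := by
  rw [anti, anti, Finset.sum_range_add, add_eq_left, Finset.sum_sub_distrib, Finset.sum_const,
    Finset.card_range, nsmul_eq_mul, sub_eq_zero]
  have h := sum_range_shift_of_periodic hu n
  have e : ∑ i ∈ Finset.range q, u (n + i + 1) = ∑ x ∈ Finset.range q, u (n + x + 1) := rfl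
  rw [show (∑ x ∈ Finset.range q, u (n + x + 1)) = ∑ i ∈ Finset.range q, u (i + 1) from h, mean,
    mul_div_cancel₀]
  exact_mod_cast hq.ne'

/-- The mean is bounded by the sup. [folklore] -/
theorem norm_mean_le {q : ℕ} (hq : 0 < q) {u : ℕ → ℂ} {B : ℝ} (hB : ∀ n, ‖u n‖ ≤ B) :
    ‖mean q u‖ ≤ B := by
  rw [mean, norm_div, Complex.norm_natCast, div_le_iff₀ (by exact_mod_cast hq)]
  calc ‖∑ i ∈ Finset.range q, u (i + 1)‖ ≤ ∑ i ∈ Finset.range q, ‖u (i + 1)‖ := norm_sum_le _ _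
    _ ≤ ∑ _i ∈ Finset.range q, B := Finset.sum_le_sum fun i _ ↦ hB _
    _ = B * q := by rw [Finset.sum_const, Finset.card_range, nsmul_eq_mul, mul_comm]

/-- The periodic antiderivative is bounded by `2 q B`. [folklore] -/
theorem norm_anti_le {q : ℕ} (hq : 0 < q) {u : ℕ → ℂ} (hu : ∀ n, u (n + q) = u n) {B : ℝ}
    (hB : ∀ n, ‖u n‖ ≤ B) (n : ℕ) : ‖anti q u n‖ ≤ 2 * q * B := by
  have hB0 : 0 ≤ B := (norm_nonneg _).trans (hB 0)
  -- reduce to `n < q`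
  have hred : ∀ n, anti q u n = anti q u (n % q) := by
    intro n
    conv_lhs => rw [← Nat.mod_add_div n q]
    generalize n / q = k
    induction k with
    | zero => simp
    | succ k ih => rw [Nat.mul_succ, ← add_assoc, anti_periodic hq hu, ih]
  rw [hred n]
  have hlt : n % q < q := Nat.mod_lt n hq
  rw [anti]
  calc ‖∑ i ∈ Finset.range (n % q), (u (i + 1) - mean q u)‖
      ≤ ∑ i ∈ Finset.range (n % q), ‖u (i + 1) - mean q u‖ := norm_sum_le _ _
    _ ≤ ∑ _i ∈ Finset.range (n % q), 2 * B := Finset.sum_le_sum fun i _ ↦ by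
        calc ‖u (i + 1) - mean q u‖ ≤ ‖u (i + 1)‖ + ‖mean q u‖ := norm_sub_le _ _
          _ ≤ B + B := add_le_add (hB _) (norm_mean_le hq hB)
          _ = 2 * B := by ring
    _ = (n % q : ℕ) * (2 * B) := by rw [Finset.sum_const, Finset.card_range, nsmul_eq_mul]
    _ ≤ q * (2 * B) := by gcongr
    _ = 2 * q * B := by ring

/-! ### The tail series `T_j(u) = Σ_{m > N} u(m) Δ^j(m^{-s})` -/

section Tail

variable {s : ℂ} (hs : 0 < s.re) (N : ℕ)

/-- The sequence `m ↦ Δ^j(m^{-s})`. [folklore] -/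
def Dseq (s : ℂ) (j : ℕ) (m : ℕ) : ℂ := fdPow j s m

/-- [folklore] -/
theorem fdiff_Dseq (s : ℂ) (j : ℕ) : fdiff (Dseq s j) = Dseq s (j + 1) := by
  funext n; exact fdiff_fdPow j s n

include hs in
/-- `‖Δ^j(m^{-s})‖ ≤ (‖s‖ + j)^j m^{-σ-j}` for `m ≥ 1`. [folklore] -/
theorem norm_Dseq_le (j : ℕ) {m : ℕ} (hm : 1 ≤ m) :
    ‖Dseq s j m‖ ≤ (‖s‖ + j) ^ j * (m : ℝ) ^ (-s.re - j) :=
  norm_fdPow_le j s hs.le (by exact_mod_cast hm)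

include hs in
/-- The shifted real majorant `(n+N+1)^{-σ-j}` is summable for `j ≥ 1`. [folklore] -/
theorem summable_shift_rpow {j : ℕ} (hj : 1 ≤ j) :
    Summable (fun n : ℕ ↦ ((n + N + 1 : ℕ) : ℝ) ^ (-s.re - j)) := by
  have hj' : (1 : ℝ) ≤ j := by exact_mod_cast hj
  have h := Real.summable_nat_rpow.2 (show -s.re - j < -1 by linarith)
  have e : (fun n : ℕ ↦ ((n + N + 1 : ℕ) : ℝ) ^ (-s.re - j)) =
      (fun n : ℕ ↦ (n : ℝ) ^ (-s.re - j)) ∘ (fun n : ℕ ↦ n + N + 1) := by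
    funext n; simp
  rw [e]
  exact h.comp_injective fun a b hab ↦ by simpa using hab

include hs in
/-- `Σ_n ‖Δ^j((n+N+1)^{-s})‖` converges for `j ≥ 1`. [folklore] -/
theorem summable_norm_Dseq {j : ℕ} (hj : 1 ≤ j) :
    Summable (fun n : ℕ ↦ ‖Dseq s j (n + N + 1)‖) := by
  refine Summable.of_nonneg_of_le (fun n ↦ norm_nonneg _)
    (fun n ↦ norm_Dseq_le hs j (by omega)) ((summable_shift_rpow hs N hj).mul_left _)

include hs in
/-- `Δ^j(m^{-s}) → 0`. [folklore] -/
theorem tendsto_Dseq (j : ℕ) : Tendsto (Dseq s j) atTop (𝓝 0) := by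
  have hlim : Tendsto (fun m : ℕ ↦ (‖s‖ + j) ^ j * (m : ℝ) ^ (-s.re - j)) atTop (𝓝 0) := by
    have h1 : Tendsto (fun m : ℕ ↦ (m : ℝ) ^ (-s.re - j)) atTop (𝓝 0) := by
      have h := (tendsto_rpow_neg_atTop (show 0 < s.re + j by positivity)).comp
        tendsto_natCast_atTop_atTop
      refine h.congr fun m ↦ ?_
      simp only [Function.comp_apply]; congr 1; ring
    have := h1.const_mul ((‖s‖ + j) ^ j)
    rwa [mul_zero] at this
  refine squeeze_zero_norm' ?_ hlim
  filter_upwards [eventually_ge_atTop 1] with m hm using norm_Dseq_le hs j hm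

include hs in
/-- **Tail bound**: `Σ_n ‖Δ^j((n+N+1)^{-s})‖ ≤ (‖s‖+j)^j N^{1-σ-j}/(σ+j-1)` for `j ≥ 1`, `N ≥ 1`
(integral test). [folklore] -/
theorem tsum_norm_Dseq_le {j : ℕ} (hj : 1 ≤ j) (hN : 1 ≤ N) :
    ∑' n : ℕ, ‖Dseq s j (n + N + 1)‖ ≤
      (‖s‖ + j) ^ j * ((N : ℝ) ^ (1 - s.re - j) / (s.re + j - 1)) := by
  have hj' : (1 : ℝ) ≤ j := by exact_mod_cast hj
  have hN0 : (0 : ℝ) < N := by exact_mod_cast hN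
  set a : ℝ := -s.re - j with ha
  have ha1 : a < -1 := by rw [ha]; linarith
  set C : ℝ := (‖s‖ + j) ^ j with hC
  have hC0 : 0 ≤ C := by positivity
  -- compare with the majorant, then integral test
  have h1 : ∑' n : ℕ, ‖Dseq s j (n + N + 1)‖ ≤ ∑' n : ℕ, C * ((n + N + 1 : ℕ) : ℝ) ^ a :=
    (summable_norm_Dseq hs N hj).tsum_le_tsum (fun n ↦ norm_Dseq_le hs j (by omega))
      ((summable_shift_rpow hs N hj).mul_left C)
  refine h1.trans ?_
  rw [tsum_mul_left]
  refine mul_le_mul_of_nonneg_left ?_ hC0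
  have hanti : AntitoneOn (fun x : ℝ ↦ x ^ a) (Ici (N : ℝ)) := by
    intro x hx y hy hxy
    exact Real.rpow_le_rpow_of_nonpos (hN0.trans_le hx) hxy (by linarith)
  have hint : MeasureTheory.IntegrableOn (fun x : ℝ ↦ x ^ a) (Ioi (N : ℝ)) :=
    integrableOn_Ioi_rpow_of_lt ha1 hN0
  have hnn : ∀ t ∈ Ioi (N : ℝ), 0 ≤ t ^ a := fun t ht ↦
    Real.rpow_nonneg (hN0.le.trans (le_of_lt ht)) _
  have h2 := AntitoneOn.tsum_comp_add_le_integral N hanti hint hnn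
  refine h2.trans (le_of_eq ?_)
  rw [integral_Ioi_rpow_of_lt ha1 hN0, ha]
  have hne : s.re + j - 1 ≠ 0 := by linarith
  have hne' : -s.re - j + 1 ≠ 0 := by linarith
  rw [show -s.re - (j : ℝ) + 1 = -(s.re + j - 1) by ring, show (1 : ℝ) - s.re - j = -(s.re + j - 1) by ring]
  field_simp

/-- The tail series `T_j(u) = Σ_{n≥0} u(n+N+1) Δ^j((n+N+1)^{-s})`. [folklore] -/
def tailSum (s : ℂ) (N : ℕ) (j : ℕ) (u : ℕ → ℂ) : ℂ := ∑' n : ℕ, u (n + N + 1) * Dseq s j (n + N + 1)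

include hs in
/-- Summability of the tail series for bounded `u`, `j ≥ 1`. [folklore] -/
theorem summable_tailSum {j : ℕ} (hj : 1 ≤ j) {u : ℕ → ℂ} {B : ℝ} (hB : ∀ n, ‖u n‖ ≤ B) :
    Summable (fun n : ℕ ↦ u (n + N + 1) * Dseq s j (n + N + 1)) := by
  refine Summable.of_norm_bounded ((summable_norm_Dseq hs N hj).mul_left B) fun n ↦ ?_
  rw [norm_mul]
  exact mul_le_mul_of_nonneg_right (hB _) (norm_nonneg _)

include hs in
/-- The crude bound `‖T_j(u)‖ ≤ B Σ ‖Δ^j‖`. [folklore] -/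
theorem norm_tailSum_le {j : ℕ} (hj : 1 ≤ j) {u : ℕ → ℂ} {B : ℝ} (hB : ∀ n, ‖u n‖ ≤ B) :
    ‖tailSum s N j u‖ ≤ B * ∑' n : ℕ, ‖Dseq s j (n + N + 1)‖ := by
  rw [tailSum, ← tsum_mul_left]
  refine tsum_of_norm_bounded ((summable_norm_Dseq hs N hj).mul_left B).hasSum fun n ↦ ?_
  rw [norm_mul]
  exact mul_le_mul_of_nonneg_right (hB _) (norm_nonneg _)

include hs in
/-- **One Abel step on the tail series.** For a `q`-periodic `u` with mean `μ` and mean-free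
antiderivative `U` (`IteratedAbel.anti`), and `j ≥ 1`:
`T_j(u) = −μ Δ^{j-1}((N+1)^{-s}) − U(N) Δ^j((N+1)^{-s}) − T_{j+1}(U)`.
[cite: MontgomeryVaughan2007, §1.3 Thm. 1.3] -/
theorem tailSum_eq {q : ℕ} (hq : 0 < q) {j : ℕ} (hj : 1 ≤ j) {u : ℕ → ℂ}
    (hu : ∀ n, u (n + q) = u n) {B : ℝ} (hB : ∀ n, ‖u n‖ ≤ B) :
    tailSum s N j u = -(mean q u * Dseq s (j - 1) (N + 1)) -
      anti q u N * Dseq s j (N + 1) - tailSum s N (j + 1) (anti q u) := by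
  have hB0 : 0 ≤ B := (norm_nonneg _).trans (hB 0)
  have hU := norm_anti_le hq hu hB
  -- split `u = ΔU + μ`
  have hsplit : ∀ n, u (n + N + 1) * Dseq s j (n + N + 1) =
      (anti q u (n + N + 1) - anti q u (n + N)) * Dseq s j (n + N + 1) +
        mean q u * Dseq s j (n + N + 1) := by
    intro n
    rw [anti_succ_sub]; ring
  have hs1 : Summable fun n ↦ (anti q u (n + N + 1) - anti q u (n + N)) * Dseq s j (n + N + 1) := by
    refine Summable.of_norm_bounded ((summable_norm_Dseq hs N hj).mul_left (2 * (2 * q * B)))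
      fun n ↦ ?_
    rw [norm_mul]
    refine mul_le_mul_of_nonneg_right ?_ (norm_nonneg _)
    calc ‖anti q u (n + N + 1) - anti q u (n + N)‖
        ≤ ‖anti q u (n + N + 1)‖ + ‖anti q u (n + N)‖ := norm_sub_le _ _
      _ ≤ 2 * q * B + 2 * q * B := add_le_add (hU _) (hU _)
      _ = 2 * (2 * q * B) := by ring
  have hs2 : Summable fun n ↦ mean q u * Dseq s j (n + N + 1) :=
    (summable_tailSum hs N hj (B := 1) (u := fun _ ↦ 1) (fun n ↦ by simp)).mul_left (mean q u)
      |>.congr fun n ↦ by ring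
  have hs3 : Summable fun n ↦ anti q u (n + N + 1) * fdiff (Dseq s j) (n + N + 1) := by
    rw [fdiff_Dseq]
    exact summable_tailSum hs N (by omega) hU
  rw [tailSum, tsum_congr hsplit, hs1.tsum_add hs2, tsum_abel hU (tendsto_Dseq hs j) N hs1 hs3,
    tsum_mul_left, fdiff_Dseq]
  -- the telescoping sum `Σ Δ^j = -Δ^{j-1}(N+1)`
  obtain ⟨i, rfl⟩ : ∃ i, j = i + 1 := ⟨j - 1, by omega⟩
  have htel : ∑' n : ℕ, Dseq s (i + 1) (n + N + 1) = -Dseq s i (N + 1) := by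
    have hF := hasSum_fdiff (F := Dseq s i) (N + 1) (tendsto_Dseq hs i) ?_
    · rw [fdiff_Dseq] at hF
      have e : (fun n : ℕ ↦ Dseq s (i + 1) (n + (N + 1))) = fun n ↦ Dseq s (i + 1) (n + N + 1) := by
        funext n; rw [add_assoc]
      rw [e] at hF
      exact hF.tsum_eq
    · rw [fdiff_Dseq]
      have h := summable_tailSum hs N (by omega : 1 ≤ i + 1) (B := 1) (u := fun _ ↦ 1)
        (fun n ↦ by simp)
      simp only [one_mul] at h
      refine h.congr fun n ↦ ?_
      rw [add_assoc]
  rw [htel, show i + 1 - 1 = i by omega, tailSum]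
  ring

include hs in
/-- Boundary terms: `‖Δ^i((N+1)^{-s})‖ ≤ N^{-σ}` whenever `‖s‖ + i ≤ N`. [folklore] -/
theorem norm_Dseq_succ_le {i : ℕ} (hN : 1 ≤ N) (hi : ‖s‖ + i ≤ N) :
    ‖Dseq s i (N + 1)‖ ≤ (N : ℝ) ^ (-s.re) := by
  have hN0 : (0 : ℝ) < N := by exact_mod_cast hN
  have hN1 : (0 : ℝ) < (N + 1 : ℕ) := by positivity
  refine (norm_Dseq_le hs i (by omega : 1 ≤ N + 1)).trans ?_
  have e : ((N + 1 : ℕ) : ℝ) ^ (-s.re - i) =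
      ((N + 1 : ℕ) : ℝ) ^ (-s.re) * ((N + 1 : ℕ) : ℝ) ^ (-(i : ℝ)) := by
    rw [← Real.rpow_add hN1, sub_eq_add_neg]
  rw [e, ← mul_assoc, mul_comm ((‖s‖ + i) ^ i), mul_assoc]
  have h1 : ((N + 1 : ℕ) : ℝ) ^ (-s.re) ≤ (N : ℝ) ^ (-s.re) :=
    Real.rpow_le_rpow_of_nonpos hN0 (by push_cast; linarith) (by linarith)
  have h2 : (‖s‖ + i) ^ i * ((N + 1 : ℕ) : ℝ) ^ (-(i : ℝ)) ≤ 1 := by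
    rw [Real.rpow_neg hN1.le, Real.rpow_natCast]
    rw [mul_inv_le_iff₀ (pow_pos hN1 i), one_mul]
    exact pow_le_pow_left₀ (by positivity) (hi.trans (by push_cast; linarith)) i
  calc ((N + 1 : ℕ) : ℝ) ^ (-s.re) * ((‖s‖ + i) ^ i * ((N + 1 : ℕ) : ℝ) ^ (-(i : ℝ)))
      ≤ (N : ℝ) ^ (-s.re) * 1 :=
        mul_le_mul h1 h2 (by positivity) (Real.rpow_nonneg hN0.le _)
    _ = (N : ℝ) ^ (-s.re) := mul_one _

include hs in
/-- **The iterated bound.** With `X = N^{−σ} + (‖s‖+k)^k N^{1−σ−k}/(σ+k−1)` and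
`‖s‖ + k ≤ N`: for `j + d = k`, `j ≥ 1`, every `q`-periodic `u` with `‖u‖ ≤ B` has
`‖T_j(u)‖ ≤ B (6q)^d X` (induction on `d`, one Abel step each). [folklore] -/
theorem norm_tailSum_le_of_add_eq {q : ℕ} (hq : 0 < q) {k : ℕ} (hN : 1 ≤ N)
    (hk : ‖s‖ + k ≤ N) (d : ℕ) :
    ∀ (j : ℕ), 1 ≤ j → j + d = k → ∀ (u : ℕ → ℂ) (B : ℝ), (∀ n, u (n + q) = u n) →
      (∀ n, ‖u n‖ ≤ B) →
      ‖tailSum s N j u‖ ≤ B * (6 * q) ^ d *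
        ((N : ℝ) ^ (-s.re) + (‖s‖ + k) ^ k * ((N : ℝ) ^ (1 - s.re - k) / (s.re + k - 1))) := by
  have hN0 : (0 : ℝ) < N := by exact_mod_cast hN
  have hq1 : (1 : ℝ) ≤ q := by exact_mod_cast hq
  set X : ℝ := (N : ℝ) ^ (-s.re) + (‖s‖ + k) ^ k * ((N : ℝ) ^ (1 - s.re - k) / (s.re + k - 1))
    with hX
  induction d with
  | zero =>
    intro j hj hjk u B hu hB
    have hj0 : j = k := by omega
    rw [hj0] at hj ⊢
    have hB0 : 0 ≤ B := (norm_nonneg _).trans (hB 0)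
    have hk1 : (1 : ℝ) ≤ k := by exact_mod_cast hj
    have hrem : 0 ≤ (‖s‖ + k) ^ k * ((N : ℝ) ^ (1 - s.re - k) / (s.re + k - 1)) := by
      have : 0 < s.re + k - 1 := by linarith
      positivity
    calc ‖tailSum s N k u‖ ≤ B * ∑' n : ℕ, ‖Dseq s k (n + N + 1)‖ := norm_tailSum_le hs N hj hB
      _ ≤ B * ((‖s‖ + k) ^ k * ((N : ℝ) ^ (1 - s.re - k) / (s.re + k - 1))) :=
          mul_le_mul_of_nonneg_left (tsum_norm_Dseq_le hs N hj hN) hB0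
      _ ≤ B * (6 * q) ^ 0 * X := by
          rw [pow_zero, mul_one, hX]
          refine mul_le_mul_of_nonneg_left ?_ hB0
          linarith [Real.rpow_nonneg hN0.le (-s.re)]
  | succ d ih =>
    intro j hj hjk u B hu hB
    have hB0 : 0 ≤ B := (norm_nonneg _).trans (hB 0)
    have hU := norm_anti_le hq hu hB
    have hUper := anti_periodic hq hu
    have hIH := ih (j + 1) (by omega) (by omega) (anti q u) (2 * q * B) hUper hU
    rw [tailSum_eq hs N hq hj hu hB]
    -- boundary terms
    have hc1 : ((j - 1 : ℕ) : ℝ) ≤ k := by exact_mod_cast (show j - 1 ≤ k by omega)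
    have hc2 : (j : ℝ) ≤ k := by exact_mod_cast (show j ≤ k by omega)
    have hb1 : ‖Dseq s (j - 1) (N + 1)‖ ≤ (N : ℝ) ^ (-s.re) :=
      norm_Dseq_succ_le hs N hN (by linarith)
    have hb2 : ‖Dseq s j (N + 1)‖ ≤ (N : ℝ) ^ (-s.re) :=
      norm_Dseq_succ_le hs N hN (by linarith)
    have hXge : (N : ℝ) ^ (-s.re) ≤ X := by
      rw [hX]
      have hk1 : (1 : ℝ) ≤ k := by exact_mod_cast (show 1 ≤ k by omega)
      have : 0 < s.re + k - 1 := by linarith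
      have : 0 ≤ (‖s‖ + k) ^ k * ((N : ℝ) ^ (1 - s.re - k) / (s.re + k - 1)) := by positivity
      linarith
    have hX0 : 0 ≤ X := (Real.rpow_nonneg hN0.le _).trans hXge
    have hμ := norm_mean_le hq hB
    calc ‖-(mean q u * Dseq s (j - 1) (N + 1)) - anti q u N * Dseq s j (N + 1) -
          tailSum s N (j + 1) (anti q u)‖
        ≤ ‖mean q u * Dseq s (j - 1) (N + 1)‖ + ‖anti q u N * Dseq s j (N + 1)‖ +
            ‖tailSum s N (j + 1) (anti q u)‖ := by
          calc _ ≤ ‖-(mean q u * Dseq s (j - 1) (N + 1)) - anti q u N * Dseq s j (N + 1)‖ +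
                ‖tailSum s N (j + 1) (anti q u)‖ := norm_sub_le _ _
            _ ≤ ‖-(mean q u * Dseq s (j - 1) (N + 1))‖ + ‖anti q u N * Dseq s j (N + 1)‖ +
                ‖tailSum s N (j + 1) (anti q u)‖ := by gcongr; exact norm_sub_le _ _
            _ = _ := by rw [norm_neg]
      _ ≤ B * X + 2 * q * B * X + 2 * q * B * (6 * q) ^ d * X := by
          refine add_le_add (add_le_add ?_ ?_) hIH
          · rw [norm_mul]; exact mul_le_mul hμ (hb1.trans hXge) (norm_nonneg _) hB0
          · rw [norm_mul]
            exact mul_le_mul (hU N) (hb2.trans hXge) (norm_nonneg _) (by positivity)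
      _ = B * X * (1 + 2 * q + 2 * q * (6 * q) ^ d) := by ring
      _ ≤ B * X * (6 * q) ^ (d + 1) := by
          refine mul_le_mul_of_nonneg_left ?_ (mul_nonneg hB0 hX0)
          have h6 : (1 : ℝ) ≤ (6 * q) ^ d := one_le_pow₀ (by linarith)
          rw [pow_succ]
          nlinarith
      _ = B * (6 * q) ^ (d + 1) * X := by ring

end Tail

/-! ### The `L`-function -/

/-- **`L(s, χ)` in `Re s > 0` by `k`-fold Abel summation.** Let `χ ≠ χ₀` be a Dirichlet character
mod `q`, `k ≥ 1`, `Re s = σ > 0` and `N` an integer with `‖s‖ + k ≤ N`. Then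
`‖L(s, χ) − Σ_{n=1}^{N} χ(n) n^{−s}‖ ≤ 2q (6q)^k (N^{−σ} + (‖s‖+k)^k N^{1−σ−k}/(σ+k−1))`.
(The partial sums of `χ` are `q`-periodic and bounded by `q`; each summation by parts trades a
factor `Δ` on `n^{−s}` — `‖Δ^j(n^{−s})‖ ≤ (‖s‖+j)^j n^{−σ−j}` — for a periodic bounded
antiderivative, the means producing the boundary terms. This is the elementary substitute, for
periodic coefficients, of Euler–Maclaurin summation of order `k`: with `N ≈ T^{1+1/(k−1)}` it
approximates `L(σ+it, χ)`, `|t| ≤ T`, by a Dirichlet polynomial of length `N` up to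
`O(N^{−σ})`.) [cite: MontgomeryVaughan2007, §1.3 Thm. 1.3 and §4.3 Thm. 4.8] -/
theorem norm_LFunction_sub_sum_le_iterated {q : ℕ} [NeZero q] (χ : DirichletCharacter ℂ q)
    (hχ : χ ≠ 1) {k : ℕ} (hk : 1 ≤ k) {s : ℂ} (hs : 0 < s.re) {N : ℕ} (hN : ‖s‖ + k ≤ N) :
    ‖χ.LFunction s - ∑ n ∈ Finset.range N, χ ((n + 1 : ℕ) : ZMod q) * ((n + 1 : ℕ) : ℂ) ^ (-s)‖ ≤
      2 * q * (6 * q) ^ k *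
        ((N : ℝ) ^ (-s.re) + (‖s‖ + k) ^ k * ((N : ℝ) ^ (1 - s.re - k) / (s.re + k - 1))) := by
  have hq : 0 < q := Nat.pos_of_ne_zero (NeZero.ne q)
  have hq1 : (1 : ℝ) ≤ q := by exact_mod_cast hq
  have hk1 : (1 : ℝ) ≤ k := by exact_mod_cast hk
  have hN1r : (1 : ℝ) ≤ N := by linarith [norm_nonneg s]
  have hN1 : 1 ≤ N := by exact_mod_cast hN1r
  have hN0 : (0 : ℝ) < N := by exact_mod_cast hN1
  set X : ℝ := (N : ℝ) ^ (-s.re) + (‖s‖ + k) ^ k * ((N : ℝ) ^ (1 - s.re - k) / (s.re + k - 1))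
    with hX
  -- the partial sums `S(m)` as a periodic bounded sequence
  set u : ℕ → ℂ := fun m ↦ DirichletAbel.partialSum χ m with hu
  have huper : ∀ n, u (n + q) = u n := fun n ↦ DirichletAbel.partialSum_add_level χ hχ n
  have hub : ∀ n, ‖u n‖ ≤ q := fun n ↦ DirichletAbel.norm_partialSum_le χ hχ n
  -- the Abel tail: `∑' term χ (n+N) s = -T_1(S)`
  have hterm : ∀ n, DirichletAbel.term χ (n + N) s = -(u (n + N + 1) * Dseq s 1 (n + N + 1)) := by
    intro n
    rw [DirichletAbel.term, hu, Dseq, fdPow_succ, fdPow_zero, fdPow_zero]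
    push_cast
    ring_nf
  have hT : ∑' n : ℕ, DirichletAbel.term χ (n + N) s = -tailSum s N 1 u := by
    rw [tsum_congr hterm, tsum_neg, tailSum]
  rw [DirichletAbel.LFunction_sub_sum_eq χ hχ hs N, hT]
  -- the bounds
  have hT1 : ‖tailSum s N 1 u‖ ≤ q * (6 * q) ^ (k - 1) * X := by
    have h := norm_tailSum_le_of_add_eq hs N hq hN1 hN (k - 1) 1 le_rfl (by omega) u q huper hub
    rwa [← hX] at h
  have hbdry : ‖DirichletAbel.partialSum χ N * ((N + 1 : ℕ) : ℂ) ^ (-s)‖ ≤ q * X := by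
    rw [norm_mul]
    have h1 : ‖((N + 1 : ℕ) : ℂ) ^ (-s)‖ ≤ (N : ℝ) ^ (-s.re) := by
      have h := norm_Dseq_succ_le hs N hN1 (i := 0) (by simpa using (le_trans (by
        have : (0:ℝ) ≤ k := by positivity
        linarith) hN))
      rwa [Dseq, fdPow_zero] at h
    have hXge : (N : ℝ) ^ (-s.re) ≤ X := by
      rw [hX]
      have hk1 : (1 : ℝ) ≤ k := by exact_mod_cast hk
      have : 0 < s.re + k - 1 := by linarith
      have : 0 ≤ (‖s‖ + k) ^ k * ((N : ℝ) ^ (1 - s.re - k) / (s.re + k - 1)) := by positivity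
      linarith
    exact mul_le_mul (hub N) (h1.trans hXge) (norm_nonneg _) (by positivity)
  have hX0 : 0 ≤ X := by
    rw [hX]
    have hk1 : (1 : ℝ) ≤ k := by exact_mod_cast hk
    have : 0 < s.re + k - 1 := by linarith
    positivity
  have hpow : (6 * (q : ℝ)) ^ (k - 1) ≤ (6 * q) ^ k :=
    pow_le_pow_right₀ (by linarith) (Nat.sub_le k 1)
  calc ‖-tailSum s N 1 u - DirichletAbel.partialSum χ N * ((N + 1 : ℕ) : ℂ) ^ (-s)‖
      ≤ ‖tailSum s N 1 u‖ + ‖DirichletAbel.partialSum χ N * ((N + 1 : ℕ) : ℂ) ^ (-s)‖ := by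
        refine (norm_sub_le _ _).trans ?_; rw [norm_neg]
    _ ≤ q * (6 * q) ^ (k - 1) * X + q * X := add_le_add hT1 hbdry
    _ ≤ q * (6 * q) ^ k * X + q * (6 * q) ^ k * X := by
        have h1 : (1 : ℝ) ≤ (6 * q) ^ k := one_le_pow₀ (by linarith)
        have hqX : 0 ≤ (q : ℝ) * X := by positivity
        nlinarith [mul_le_mul_of_nonneg_left hpow hqX]
    _ = 2 * q * (6 * q) ^ k * X := by ring

end IteratedAbel

end Literature.NumberTheory.LFunctions
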